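import Summits.QuantumAdvantage.QuantumAdvantage.Theorems.WalkTwoStepPartLocality
import Summits.QuantumAdvantage.QuantumAdvantage.Theorems.WalkTwoStepFarLocalFlip

/-!
# (G♯) local engine — `DensePinned p` by INVOLUTION PEELING, 1/5: objects and the sequential cylinder count

Route `OddPrimeWalk`, support item stmt-QuantumAdvantage-23121 (`TwoStepFreeRungFive`, rung (G♯): genuine two-step linear
selectors over `𝔽₅` lose the u-walk game on a constant fraction of inputs).  The tree already holds
`LocalEngine.twoStepFreeRungFive_of_densePinned : DensePinned 5 → TwoStepFreeRungFive` (`WalkTwoStepFarLocal.lean`, with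
`FarLocal 5` and `SparsePinned 5` proved); this module proves the last hypothesis

* `DensePeel.densePinned_of_prime (p) [Fact p.Prime] (hp5 : 5 ≤ p) : DensePinned p`, `DensePeel.densePinned_five : DensePinned 5`,

and closes the item: `Summit.QuantumAdvantage.QuantumAdvantage.Theorems.oddPrimeWalk_twoStepFreeRungFive : OddPrimeWalk.TwoStepFreeRungFive`.

MODULES (≤ 400 lines each): 1/5 `WalkTwoStepDensePeelCylinder` (§0 objects, §2 cylinder count) · 2/5 `WalkTwoStepDensePeelFlips`
(§3 involution peeling, §4 corner flips / block form / reachability / selection) · 3/5 `WalkTwoStepDensePeelFrame` (§4b C1–C3: window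
arithmetic, fire residues, parity, odd row, the frame of one lifted input) · 4/5 `WalkTwoStepDensePeelCriterion` (§4b C4 the criterion, §5a
per-lift peeling and counting) · 5/5 `OddPrimeWalkTwoStepFreeRungFive` (§5b composition, `densePinned_five`, the item).  THIS MODULE: 1/5.

## Statement recalled

`DensePinned p` (`WalkTwoStepLocalEngineGlue.lean`): for every `d₀` there are `δ < 1 ≤ K` and `C` with, for every two-step
strategy `S`, class `w`, boundary/pin pattern `u₀` and charge `c`,
`|#winPart − #part/2| ≤ C · 2ⁿ · δ ^ effOn(part) · K ^ #pinTimes`, where `part = part S d₀ w u₀` is the set of inputs of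
weight class `w` with prescribed prefix residues at the pin times and prescribed boundary bits, and `effOn` counts the cuts whose
status is non-constant on the part.

## Architecture (C): involution peeling (no transfer operators, no conditioning)

1. **Usable positions** (`Usable`, §0).  A position `τ` is usable if it has room `d₀ + 3p` on the left and `d₀ + p + 1` on the right,
   is not a pin time, is not the split of the endpoint cuts `0, n`, and the cut sitting AT position `τ` is effective on the part.
   Every effective cut sits at a usable position up to `2d₀ + 4p + 3 + #pinTimes` exceptions (`effOn_le_card_usable_add`), and a
   greedy selection extracts `k` usable positions pairwise `ℓ`-separated, `ℓ = 3p + 2d₀ + 1`, with `effOn ≤ ℓ k + O(d₀ + p) + #pinTimes`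
   (`select`, `part_bias_le`).
2. **The local odd-row criterion** (`criterion`, §4b — the heart).  Fix a usable `τ` and a lift `wt u ≡ w3 (mod 3)`.  There is ONE
   residue `x (mod 3p)` such that on every `u ∈ part` of that lift showing the isolated-corner WINDOW PATTERN at `τ` (`WinPat`: inside
   `[τ − d₀ − 1, τ + d₀]` the only `true` bit is at `τ − 1`) with `N(τ) = wtPrefix u τ ≡ x (mod 3p)`, the corner flip
   `ψ_τ = cornerFlip n τ` CHANGES the win bit.  Proof: `ψ_τ` preserves `wt`, every `wtPrefix` at `g ≠ τ`, and lowers `N(τ)` by one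
   (C1); hence only cuts with position `τ` (the own cut `g₀`) or split `s_h = τ` (co-observers, all NEAR since `τ` is not a pin
   time) can change status (C3).  Choose `x ≡ e (mod 3)` with the own cut DEAD before and LIVE after the flip; then the own cut changes
   status iff it fires after the flip, i.e. iff `ξ = x mod p` lies in a set `A g₀` of ODD size (`univ` if its fire bit is constant
   on the part — effectiveness then forces firing —, else the singleton fire residue `{a_{g₀}}` or `{a_{g₀}+1}`, `fire_iff`), while a
   genuine co-observer `h` changes status iff it is live (a constant `liveC`) and `ξ ∈ {a_h, a_h + 1}` — a set of EVEN size
   (`Frame.status_co_iff`).  The ODD ROW (`exists_odd_fiber`: Σ_ξ #{h : ξ ∈ A h} = Σ_h #A h is odd) gives a `ξ` at which an odd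
   number of statuses change, so the parity of the status sum — the win bit, `ringWinU_eq_true_iff_odd_sum` — flips
   (`odd_sum_toNat_add_iff`); CRT mod `3p` (`crt3`) combines `ξ` and `e`.
3. **Involution peeling** (`peel`, §3).  The flips `ψ_{τ_i}` at `ℓ`-separated usable positions are commuting involutions preserving
   the lifted part and each other's peeling events `E_i = WinPat ∧ N(τ_i) ≡ x_i`; an involution flipping `win` on `Q ∩ E_i` splits
   that set evenly (`card_filter_eq_half`), so `|#win(Q) − #Q/2| ≤ #(Q ∖ ⋃ E_i)/2` by induction on the positions.
4. **Cylinder count** (`cylinder_count`, §2).  The event `E_i` is decided by the entry prefix weight and the `ℓ` block bits on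
   `[τ_i − d₀ − 3p, τ_i + d₀]` (`peelEvent_of_blockEvent`) and is REACHABLE from every entry weight (`blockEvent_reachable`: the
   `3p` free bits before the window realise every residue); overwriting disjoint blocks is a bijection, so
   `#{u : no E_i} ≤ 2ⁿ (1 − 2^{−ℓ})^k` (`cylinder_step`, double counting over `(u, b) ↦ overwrite u A b`).
5. **Composition** (§5).  Three lifts `w3`, `lift_bias_le`, then `part_bias_le`; constants `q = 2^{−ℓ}`, `δ = 1 − q/ℓ` (so that
   `(1 − q)^k ≤ δ^{ℓ k}`), `K = δ⁻¹`, `J = (ℓ − 1) + (2d₀ + 4p + 3)`, `C = (3/2) K^J` (`densePinned_of_prime`).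

Validation before typing: `HOME/qa-qnc0-p2/line26/crit_check.py` (brute force, n ≤ 11, p = 5: 0 violations of the single-flip
discordance formula in 11 072 checks and of the odd-row recipe in 294 423 usable instances, seeds 1/7/11).

Authored by planner qa-qnc0-p2 (gen 26) as a service to the provers of stmt-QuantumAdvantage-23121; kernel-checked on the farm
(rc 0, 0 sorry, axioms `propext, Classical.choice, Quot.sound`).
-/

namespace Summit.QuantumAdvantage.AdviceFreeQNC0.LocalEngine

open Finset Classical
open Summit.QuantumAdvantage.AdviceFreeQNC0.Coset21.RungG (classOf)

namespace DensePeel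

/-! ### §0 Objects -/

section Objects

variable {p n : ℕ}

/-- the block length `ℓ = 3p + 2d₀ + 1` of one peeling position. -/
def ell (p d₀ : ℕ) : ℕ := 3 * p + 2 * d₀ + 1

/-- the WINDOW PATTERN of an isolated corner at `τ`: inside `[τ − d₀ − 1, τ + d₀]` the only `true` bit sits at `τ − 1`. -/
def WinPat (n d₀ τ : ℕ) (u : Fin n → Bool) : Prop :=
  ∀ i : Fin n, τ ≤ i.val + d₀ + 1 → i.val ≤ τ + d₀ → (u i = true ↔ i.val + 1 = τ)

/-- the PEELING EVENT at `τ` with target residue `x`: the window pattern and `N(τ) ≡ x (mod 3p)`. -/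
def peelEvent (n p d₀ τ x : ℕ) (u : Fin n → Bool) : Prop :=
  WinPat n d₀ τ u ∧ wtPrefix u τ % (3 * p) = x

/-- a USABLE flip time `τ` for the part `part S d₀ w u₀` at charge `c`: room for the block `[τ − d₀ − 3p, τ + d₀]` on the left and
for `d₀ + p + 1` coordinates on the right, not a pin time, not the split of the two endpoint cuts `0`, `n`, and the cut AT position `τ`
is effective on the part. -/
def Usable (c : ℕ) (S : TwoStep p n) (d₀ : ℕ) (w : ZMod p) (u₀ : Fin n → Bool) (τ : ℕ) : Prop :=
  d₀ + 3 * p ≤ τ ∧ τ + d₀ + p + 1 ≤ n ∧ (∀ t ∈ pinTimes S d₀, t.val ≠ τ) ∧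
    S.s 0 ≠ τ ∧ S.s (Fin.last n) ≠ τ ∧
    ∃ g : Fin (n + 1), g.val = τ ∧ ∃ u ∈ part S d₀ w u₀, ∃ v ∈ part S d₀ w u₀, status c S g u ≠ status c S g v

/-- the bits of `u` on the block `[a, a + ℓ)` (junk `false` beyond `n`). -/
def blockBits (u : Fin n → Bool) (a ℓ : ℕ) : Fin ℓ → Bool :=
  fun j => if h : a + j.val < n then u ⟨a + j.val, h⟩ else false

/-- BLOCK FORM of the peeling event at `τ` (target residue `x`): a predicate of the entry prefix weight `z = N(τ − d₀ − 3p)` and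
the `ℓ` block bits `b` on `[τ − d₀ − 3p, τ + d₀]`. -/
def blockEvent (p d₀ τ x : ℕ) (z : ℕ) (b : Fin (ell p d₀) → Bool) : Prop :=
  (∀ j : Fin (ell p d₀), τ ≤ (τ - d₀ - 3 * p) + j.val + d₀ + 1 → (b j = true ↔ (τ - d₀ - 3 * p) + j.val + 1 = τ)) ∧
    (z + ((univ : Finset (Fin (ell p d₀))).filter fun j => (τ - d₀ - 3 * p) + j.val < τ ∧ b j = true).card) % (3 * p) = x

end Objects

/-! ### §2 The sequential cylinder count (PROVED) -/

section Cylinder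

variable {n : ℕ}

/-- overwrite the block `[A, A + ℓ)` of `u` with `b`. -/
def overwrite (u : Fin n → Bool) (A : ℕ) {ℓ : ℕ} (b : Fin ℓ → Bool) : Fin n → Bool :=
  fun i => if h : A ≤ i.val ∧ i.val < A + ℓ then b ⟨i.val - A, by omega⟩ else u i

/-- outside the block `[A, A + ℓ)` the overwrite leaves `u` unchanged. -/
theorem overwrite_apply_of_not (u : Fin n → Bool) (A : ℕ) {ℓ : ℕ} (b : Fin ℓ → Bool) (i : Fin n)
    (hi : ¬ (A ≤ i.val ∧ i.val < A + ℓ)) : overwrite u A b i = u i := by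
  unfold overwrite
  rw [dif_neg hi]

/-- inside the block `[A, A + ℓ)` the overwrite writes the block bits `b`. -/
theorem overwrite_apply_of_mem (u : Fin n → Bool) (A : ℕ) {ℓ : ℕ} (b : Fin ℓ → Bool) (i : Fin n)
    (hi : A ≤ i.val ∧ i.val < A + ℓ) : overwrite u A b i = b ⟨i.val - A, by omega⟩ := by
  unfold overwrite
  rw [dif_pos hi]

/-- reading back the block just written returns `b` (block inside `[0, n)`). -/
theorem blockBits_overwrite (u : Fin n → Bool) (A : ℕ) {ℓ : ℕ} (b : Fin ℓ → Bool) (hA : A + ℓ ≤ n) :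
    blockBits (overwrite u A b) A ℓ = b := by
  funext j
  unfold blockBits
  rw [dif_pos (by omega)]
  rw [overwrite_apply_of_mem u A b _ (by simp only; omega)]
  congr 1
  apply Fin.ext
  simp

/-- overwriting a block with its own bits does nothing. -/
theorem overwrite_blockBits (u : Fin n → Bool) (A ℓ : ℕ) : overwrite u A (blockBits u A ℓ) = u := by
  funext i
  unfold overwrite blockBits
  split_ifs with h1 h2
  · congr 1
    apply Fin.ext
    simp only
    omega
  · exfalso
    simp only at h2
    omega
  · rfl

/-- two overwrites of the same block: the last one wins. -/
theorem overwrite_overwrite (u : Fin n → Bool) (A : ℕ) {ℓ : ℕ} (b c : Fin ℓ → Bool) :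
    overwrite (overwrite u A b) A c = overwrite u A c := by
  funext i
  unfold overwrite
  split_ifs with h <;> rfl

/-- prefix weights below `g` only depend on the bits below `g`. -/
theorem wtPrefix_congr_below (u v : Fin n → Bool) (g : ℕ) (h : ∀ i : Fin n, i.val < g → u i = v i) :
    wtPrefix u g = wtPrefix v g := by
  unfold wtPrefix
  congr 1
  apply Finset.filter_congr
  intro i _
  constructor
  · rintro ⟨h1, h2⟩
    exact ⟨h1, by rw [← h i h1]; exact h2⟩
  · rintro ⟨h1, h2⟩
    exact ⟨h1, by rw [h i h1]; exact h2⟩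

/-- an overwrite at `A ≥ g` does not change the prefix weight `N(g)`. -/
theorem wtPrefix_overwrite_of_le (u : Fin n → Bool) (A : ℕ) {ℓ : ℕ} (b : Fin ℓ → Bool) {g : ℕ} (hg : g ≤ A) :
    wtPrefix (overwrite u A b) g = wtPrefix u g :=
  wtPrefix_congr_below _ _ g fun i hi => overwrite_apply_of_not u A b i (by omega)

/-- an overwrite at `A` does not change the bits of an earlier block `[a, a + ℓ') ⊆ [0, A)`. -/
theorem blockBits_overwrite_of_le (u : Fin n → Bool) (A : ℕ) {ℓ : ℕ} (b : Fin ℓ → Bool) {a ℓ' : ℕ}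
    (h : a + ℓ' ≤ A) : blockBits (overwrite u A b) a ℓ' = blockBits u a ℓ' := by
  funext j
  unfold blockBits
  split_ifs with h1
  · exact overwrite_apply_of_not u A b _ (by simp only; omega)
  · rfl

/-- **One cylinder step.** If `R` does not read the block `[A, A + ℓ)` and from every entry prefix weight some block content is good,
then the inputs of `R` with a bad block are at most a `(1 − 2^{−ℓ})` fraction of `R` (double count over `(u, b) ↦ overwrite u A b`). -/
theorem cylinder_step {ℓ : ℕ} (A : ℕ) (hA : A + ℓ ≤ n) (Gk : ℕ → (Fin ℓ → Bool) → Prop) (hGk : ∀ z, ∃ b, Gk z b)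
    (R : (Fin n → Bool) → Prop) [DecidablePred R] (hR : ∀ u (b : Fin ℓ → Bool), R (overwrite u A b) ↔ R u) :
    ((((univ : Finset (Fin n → Bool)).filter fun u => R u ∧ ¬ Gk (wtPrefix u A) (blockBits u A ℓ)).card : ℝ))
      ≤ (1 - (1 / 2 : ℝ) ^ ℓ) * (((univ : Finset (Fin n → Bool)).filter fun u => R u).card : ℝ) := by
  choose bstar hbstar using hGk
  set Bad := ((univ : Finset (Fin n → Bool)).filter fun u => R u ∧ ¬ Gk (wtPrefix u A) (blockBits u A ℓ)) with hBad
  set BadR := ((univ : Finset (Fin n → Bool)).filter fun u => R u) with hBadR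
  have hmaps : Set.MapsTo (fun x : (Fin n → Bool) × (Fin ℓ → Bool) => overwrite x.1 A x.2)
      ((Bad ×ˢ (univ : Finset (Fin ℓ → Bool)) : Finset ((Fin n → Bool) × (Fin ℓ → Bool))) : Set _)
      (BadR : Set (Fin n → Bool)) := by
    intro x hx
    rw [Finset.mem_coe, Finset.mem_product, hBad, Finset.mem_filter] at hx
    rw [Finset.mem_coe, hBadR, Finset.mem_filter]
    exact ⟨Finset.mem_univ _, (hR x.1 x.2).mpr hx.1.2.1⟩
  have hsum := Finset.card_eq_sum_card_fiberwise hmaps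
  have hfib : ∀ v ∈ BadR,
      ((Bad ×ˢ (univ : Finset (Fin ℓ → Bool))).filter
        fun x : (Fin n → Bool) × (Fin ℓ → Bool) => overwrite x.1 A x.2 = v).card ≤ 2 ^ ℓ - 1 := by
    intro v _
    have h := Finset.card_le_card_of_injOn
      (s := (Bad ×ˢ (univ : Finset (Fin ℓ → Bool))).filter
        fun x : (Fin n → Bool) × (Fin ℓ → Bool) => overwrite x.1 A x.2 = v)
      (t := (univ : Finset (Fin ℓ → Bool)).erase (bstar (wtPrefix v A)))
      (fun x : (Fin n → Bool) × (Fin ℓ → Bool) => blockBits x.1 A ℓ) ?_ ?_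
    · rwa [Finset.card_erase_of_mem (Finset.mem_univ _), Finset.card_univ, Fintype.card_fun, Fintype.card_bool,
        Fintype.card_fin] at h
    · intro x hx
      rw [Finset.mem_coe, Finset.mem_filter, Finset.mem_product, hBad, Finset.mem_filter] at hx
      obtain ⟨⟨⟨_, hRx, hGx⟩, _⟩, hxv⟩ := hx
      rw [Finset.mem_coe, Finset.mem_erase]
      refine ⟨?_, Finset.mem_univ _⟩
      intro heq
      simp only at heq
      apply hGx
      have hw : wtPrefix x.1 A = wtPrefix v A := by
        rw [← hxv, wtPrefix_overwrite_of_le x.1 A x.2 le_rfl]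
      rw [hw, heq]
      exact hbstar _
    · intro x hx y hy hxy
      rw [Finset.mem_coe, Finset.mem_filter] at hx hy
      simp only at hxy
      have hx1 : x.1 = overwrite v A (blockBits x.1 A ℓ) := by
        rw [← hx.2, overwrite_overwrite, overwrite_blockBits]
      have hy1 : y.1 = overwrite v A (blockBits y.1 A ℓ) := by
        rw [← hy.2, overwrite_overwrite, overwrite_blockBits]
      have h1 : x.1 = y.1 := by rw [hx1, hy1, hxy]
      have h2 : x.2 = y.2 := by
        rw [← blockBits_overwrite x.1 A x.2 hA, ← blockBits_overwrite y.1 A y.2 hA, hx.2, hy.2]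
      exact Prod.ext h1 h2
  have hcard : (Bad ×ˢ (univ : Finset (Fin ℓ → Bool))).card = Bad.card * 2 ^ ℓ := by
    rw [Finset.card_product, Finset.card_univ, Fintype.card_fun, Fintype.card_bool, Fintype.card_fin]
  have hle : Bad.card * 2 ^ ℓ ≤ BadR.card * (2 ^ ℓ - 1) := by
    rw [← hcard, hsum]
    refine le_trans (Finset.sum_le_sum hfib) ?_
    rw [Finset.sum_const, smul_eq_mul]
  have h3 : BadR.card * (2 ^ ℓ - 1) + BadR.card = BadR.card * 2 ^ ℓ := by
    rw [Nat.mul_sub_one, Nat.sub_add_cancel (Nat.le_mul_of_pos_right _ (Nat.two_pow_pos ℓ))]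
  have hle2 : Bad.card * 2 ^ ℓ + BadR.card ≤ BadR.card * 2 ^ ℓ := by omega
  have hT : (0 : ℝ) < (2 : ℝ) ^ ℓ := by positivity
  have hreal : (Bad.card : ℝ) * (2 : ℝ) ^ ℓ + (BadR.card : ℝ) ≤ (BadR.card : ℝ) * (2 : ℝ) ^ ℓ := by
    exact_mod_cast hle2
  have hD : (BadR.card : ℝ) / (2 : ℝ) ^ ℓ * (2 : ℝ) ^ ℓ = (BadR.card : ℝ) := div_mul_cancel₀ _ hT.ne'
  have h4 : ((Bad.card : ℝ) + (BadR.card : ℝ) / (2 : ℝ) ^ ℓ) * (2 : ℝ) ^ ℓ ≤ (BadR.card : ℝ) * (2 : ℝ) ^ ℓ := by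
    rw [add_mul, hD]
    exact hreal
  have h5 := le_of_mul_le_mul_right h4 hT
  have e : (1 / 2 : ℝ) ^ ℓ = 1 / (2 : ℝ) ^ ℓ := by rw [div_pow, one_pow]
  rw [e, sub_mul, one_mul, one_div, inv_mul_eq_div]
  linarith

/-- **The sequential cylinder count.** `k` blocks `[a i, a i + ℓ)`, increasing and `ℓ`-separated; the `i`-th event is a predicate of
the entry prefix weight `N(a i)` and the block bits, reachable from every entry weight: the inputs escaping every event number at most
`2ⁿ·(1 − 2^{−ℓ})^k` (induction on `k`, peeling the LAST block with `cylinder_step`). -/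
theorem cylinder_count {n ℓ k : ℕ} (a : Fin k → ℕ) (hsep : ∀ i j : Fin k, i < j → a i + ℓ ≤ a j) (hn : ∀ i, a i + ℓ ≤ n)
    (G : Fin k → ℕ → (Fin ℓ → Bool) → Prop) (hG : ∀ i z, ∃ b, G i z b) :
    ((((univ : Finset (Fin n → Bool)).filter fun u => ∀ i, ¬ G i (wtPrefix u (a i)) (blockBits u (a i) ℓ)).card : ℝ))
      ≤ (2 : ℝ) ^ n * (1 - (1 / 2 : ℝ) ^ ℓ) ^ k := by
  have h1q : (0 : ℝ) ≤ 1 - (1 / 2 : ℝ) ^ ℓ := by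
    have : (1 / 2 : ℝ) ^ ℓ ≤ 1 := pow_le_one₀ (by norm_num) (by norm_num)
    linarith
  induction k with
  | zero =>
    rw [pow_zero, mul_one]
    have h : (((univ : Finset (Fin n → Bool)).filter fun u => ∀ i : Fin 0, ¬ G i (wtPrefix u (a i)) (blockBits u (a i) ℓ))).card
        ≤ 2 ^ n := by
      calc _ ≤ (univ : Finset (Fin n → Bool)).card := Finset.card_filter_le _ _
        _ = 2 ^ n := by rw [Finset.card_univ, Fintype.card_fun, Fintype.card_bool, Fintype.card_fin]
    exact_mod_cast h
  | succ k ih =>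
    have hR := ih (fun i => a (Fin.castSucc i))
      (fun i j hij => hsep _ _ (Fin.castSucc_lt_castSucc_iff.mpr hij)) (fun i => hn _)
      (fun i => G (Fin.castSucc i)) (fun i z => hG _ z)
    have hlast : ∀ i : Fin k, a (Fin.castSucc i) + ℓ ≤ a (Fin.last k) :=
      fun i => hsep _ _ (Fin.castSucc_lt_last i)
    have hinv : ∀ (u : Fin n → Bool) (b : Fin ℓ → Bool),
        (∀ i : Fin k, ¬ G (Fin.castSucc i) (wtPrefix (overwrite u (a (Fin.last k)) b) (a (Fin.castSucc i)))
            (blockBits (overwrite u (a (Fin.last k)) b) (a (Fin.castSucc i)) ℓ))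
          ↔ (∀ i : Fin k, ¬ G (Fin.castSucc i) (wtPrefix u (a (Fin.castSucc i))) (blockBits u (a (Fin.castSucc i)) ℓ)) := by
      intro u b
      refine forall_congr' fun i => ?_
      rw [wtPrefix_overwrite_of_le u _ b (by have := hlast i; omega), blockBits_overwrite_of_le u _ b (hlast i)]
    have hstep := cylinder_step (n := n) (a (Fin.last k)) (hn _) (G (Fin.last k)) (hG _)
      (fun u => ∀ i : Fin k, ¬ G (Fin.castSucc i) (wtPrefix u (a (Fin.castSucc i))) (blockBits u (a (Fin.castSucc i)) ℓ))
      hinv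
    have hsub : ((univ : Finset (Fin n → Bool)).filter fun u =>
          ∀ i : Fin (k + 1), ¬ G i (wtPrefix u (a i)) (blockBits u (a i) ℓ))
        ⊆ (univ : Finset (Fin n → Bool)).filter fun u =>
          (∀ i : Fin k, ¬ G (Fin.castSucc i) (wtPrefix u (a (Fin.castSucc i))) (blockBits u (a (Fin.castSucc i)) ℓ))
            ∧ ¬ G (Fin.last k) (wtPrefix u (a (Fin.last k))) (blockBits u (a (Fin.last k)) ℓ) := by
      intro u hu
      simp only [Finset.mem_filter, Finset.mem_univ, true_and] at hu ⊢
      exact ⟨fun i => hu (Fin.castSucc i), hu (Fin.last k)⟩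
    calc ((((univ : Finset (Fin n → Bool)).filter fun u =>
            ∀ i : Fin (k + 1), ¬ G i (wtPrefix u (a i)) (blockBits u (a i) ℓ)).card : ℝ))
        ≤ (((univ : Finset (Fin n → Bool)).filter fun u =>
            (∀ i : Fin k, ¬ G (Fin.castSucc i) (wtPrefix u (a (Fin.castSucc i))) (blockBits u (a (Fin.castSucc i)) ℓ))
              ∧ ¬ G (Fin.last k) (wtPrefix u (a (Fin.last k))) (blockBits u (a (Fin.last k)) ℓ)).card : ℝ) := by
          exact_mod_cast Finset.card_le_card hsub
      _ ≤ (1 - (1 / 2 : ℝ) ^ ℓ) * ((((univ : Finset (Fin n → Bool)).filter fun u =>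
            ∀ i : Fin k, ¬ G (Fin.castSucc i) (wtPrefix u (a (Fin.castSucc i))) (blockBits u (a (Fin.castSucc i)) ℓ)).card : ℝ)) :=
          hstep
      _ ≤ (1 - (1 / 2 : ℝ) ^ ℓ) * ((2 : ℝ) ^ n * (1 - (1 / 2 : ℝ) ^ ℓ) ^ k) := mul_le_mul_of_nonneg_left hR h1q
      _ = (2 : ℝ) ^ n * (1 - (1 / 2 : ℝ) ^ ℓ) ^ (k + 1) := by ring

end Cylinder

end DensePeel

end Summit.QuantumAdvantage.AdviceFreeQNC0.LocalEngine
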